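import Summits.PneNP.PneNP.Theorems.OneSliceSliceTargetSplitStability
import Summits.PneNP.PneNP.Theorems.SingleThreshold.Negative.PlantedCliqueFree
import Summits.PneNP.PneNP.Theorems.SingleThreshold.Negative.Independence

/-!
# `MonotoneContinuation` (stmt-PneNP-18471, route PneNP/OneSlice) — negative-side lemmas II-B: the degree parity of a vertex
# is far from every monotone function in `L¹(G(n,1/n))`

Part B of the star-parity witness (assembled in `ClosenessLoadBearing.lean`): with `T = star v` the `n-1` edges at a vertex
and `parityOn T` the parity of the number of on-edges in `T`, every MONOTONE Boolean `F` satisfies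
`‖𝟙[F] − 𝟙[parityOn (star v)]‖_{L¹(G(n,1/n))} ≥ 1/8` for `n ≥ 8` (`l1_monotone_parity_ge`). Isoperimetric mechanism between the
levels `#(y ∩ T) = 1` (parity `1`, mass `(n-1)/n·(1-1/n)^{n-2} ≥ e⁻¹(n-1)/n`, computed from independence
`gnpProb_and_eq_mul` / `gnpProb_forall_off`) and `= 2` (parity `0`): `F = 1` at a level-1 vector `y` forces `F = 1` at the
`n-2` vectors `y + e'` above it, of weight `w(y)·p/(1-p) = w(y)/(n-1)` each and each hit at most twice, so the error is
`≥ min(1,(n-2)/(2(n-1)))·Pr[level 1] = (n-2)/(2n)·(1-1/n)^{n-2} ≥ (3/8)(9/25) ≥ 1/8` (`pow_one_sub_inv_ge`: `(1-1/n)^{n-1} ≥ e⁻¹ > 9/25`).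

Refuter seat refuter-cdisprove-stmt-PneNP-18471-0 (cdisprove), 2026-08-17; work file
`Summits/PneNP/PneNP/Cruxes/MonotoneContinuation/Disproof.lean`.
-/

set_option linter.dupNamespace false

namespace Summit.PneNP.PneNP.Theorems.MonotoneContinuation.Negative

open Literature.Computability.Complexity hiding supp mem_supp
open Finset hiding slice
open Filter hiding mem_sdiff
open Classical
open Summit.PneNP.PneNP.Theorems.ConstantBand.Negative (Edge thr Central central_thr slice)
open Summit.PneNP.PneNP.Theorems.SliceACZero.Negative (supp mem_supp card_supp supp_injective supp_indicator
  card_slice_supset_le)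
open Summit.PneNP.PneNP.Theorems.SingleThreshold.Negative (pc pc_nonneg pc_le_one gnpProb_and_eq_mul gnpProb_forall_off)
open Summit.PneNP.PneNP.Theorems.SliceTargetSplit (Comp nbhd mem_nbhd transport ind l1 nbhdCard
  ind_nonneg ind_le_one l1_triangle l1_eq_sum_slices card_nbhd choose_mul_nbhdCard nbhdCard_pos
  supp_subset_of_comp_of_le abs_transport_ind_sub_ind_le_one sliceSum_abs_transport_ind_sub_ind_le
  sum_card_filter_nbhd_comm choose_pred_mul_le comp_comm card_nbhd_filter_false_le)
open Summit.PneNP.PneNP.Theorems (binomialWeight_sum_range binomialWeight_nonneg binomialWeight_tail_le card_slice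
  eventually_window tendsto_mean central_add_le)

noncomputable section

variable {n : ℕ}

/-- The parity of the number of on-edges inside `T`. [folklore] -/
def parityOn (T : Finset (Edge n)) (x : Edge n → Bool) : Bool := decide (Odd #(T ∩ supp x))

/-! ### Part B. The star parity is far from monotone in `L¹(G(n,1/n))` -/

/-- The star of the vertex `v`: the `n - 1` edges at `v`. [folklore] -/
def star (v : Fin n) : Finset (Edge n) := univ.filter fun e => v ∈ (e : Sym2 (Fin n))

/-- The star has `n - 1` edges. [folklore] -/
theorem card_star (v : Fin n) : #(star v) = n - 1 := by
  have hmap : (star v).map (Function.Embedding.subtype _) = (⊤ : SimpleGraph (Fin n)).incidenceFinset v := by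
    ext e
    rw [Finset.mem_map, SimpleGraph.mem_incidenceFinset]
    constructor
    · rintro ⟨e', he', rfl⟩
      exact ⟨e'.2, (mem_filter.1 he').2⟩
    · rintro ⟨he, hv⟩
      exact ⟨⟨e, he⟩, mem_filter.2 ⟨mem_univ _, hv⟩, rfl⟩
  rw [← card_map, hmap, SimpleGraph.card_incidenceFinset_eq_degree, SimpleGraph.complete_graph_degree,
    Fintype.card_fin]

/-- Switching on one more coordinate. [folklore] -/
theorem supp_update_true (y : Edge n → Bool) (e : Edge n) : supp (Function.update y e true) = insert e (supp y) := by
  ext a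
  by_cases h : a = e
  · subst h; simp [mem_supp]
  · simp [mem_supp, h]

/-- Switching a coordinate on moves up. [folklore] -/
theorem le_update_true (y : Edge n → Bool) (e : Edge n) : y ≤ Function.update y e true := by
  intro a
  by_cases h : a = e
  · subst h; simp
  · simp [Function.update_of_ne h]

/-- Switching an off coordinate on adds one edge. [folklore] -/
theorem edgeCount_update_true {y : Edge n → Bool} {e : Edge n} (he : y e = false) :
    edgeCount (Function.update y e true) = edgeCount y + 1 := by
  rw [← card_supp, ← card_supp, supp_update_true, card_insert_of_notMem]
  rw [mem_supp, he]
  exact Bool.false_ne_true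

/-- A vector with an off coordinate is not full. [folklore] -/
theorem edgeCount_lt_of_false {y : Edge n → Bool} {e : Edge n} (he : y e = false) : edgeCount y < n.choose 2 := by
  rw [← card_supp, ← card_edgeSet_top_fin n, ← Finset.card_univ]
  apply card_lt_card
  refine ⟨subset_univ _, fun h => ?_⟩
  have := mem_supp.1 (h (mem_univ e))
  rw [he] at this
  exact Bool.false_ne_true this

/-- **Weight of the upper neighbour**: `w(y + e)·(1-p) = w(y)·p`. [folklore] -/
theorem gnpWeight_update_true (p : ℝ) {y : Edge n → Bool} {e : Edge n} (he : y e = false) :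
    gnpWeight n p (Function.update y e true) * (1 - p) = gnpWeight n p y * p := by
  have hlt := edgeCount_lt_of_false he
  rw [gnpWeight, gnpWeight, edgeCount_update_true he]
  have : n.choose 2 - edgeCount y = (n.choose 2 - (edgeCount y + 1)) + 1 := by omega
  rw [this, pow_succ, pow_succ]
  ring

/-- Star degree `1`: parity `1`. [folklore] -/
theorem parityOn_of_card_eq_one {T : Finset (Edge n)} {y : Edge n → Bool} (h : #(T ∩ supp y) = 1) :
    parityOn T y = true := by
  simp [parityOn, h]

/-- Star degree `2`: parity `0`. [folklore] -/
theorem parityOn_of_card_eq_two {T : Finset (Edge n)} {y : Edge n → Bool} (h : #(T ∩ supp y) = 2) :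
    parityOn T y = false := by
  simp [parityOn, h]

/-- `(1 - 1/n)^{n-1} ≥ e⁻¹ > 9/25` (`n ≥ 2`). [folklore] -/
theorem pow_one_sub_inv_ge {n : ℕ} (hn : 2 ≤ n) : (9 / 25 : ℝ) ≤ (1 - (n : ℝ)⁻¹) ^ (n - 1) := by
  have hn2 : (2 : ℝ) ≤ n := by exact_mod_cast hn
  set u : ℝ := (n : ℝ) - 1 with hu
  have hu0 : 0 < u := by rw [hu]; linarith
  have hcast : ((n - 1 : ℕ) : ℝ) = u := by rw [hu, Nat.cast_sub (by omega), Nat.cast_one]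
  have h1 : (1 : ℝ) + 1 / u ≤ Real.exp (1 / u) := by linarith [Real.add_one_le_exp (1 / u)]
  have h2 : ((1 : ℝ) + 1 / u) ^ (n - 1) ≤ Real.exp 1 := by
    calc ((1 : ℝ) + 1 / u) ^ (n - 1) ≤ (Real.exp (1 / u)) ^ (n - 1) := pow_le_pow_left₀ (by positivity) h1 _
      _ = Real.exp ((n - 1 : ℕ) * (1 / u)) := (Real.exp_nat_mul _ _).symm
      _ = Real.exp 1 := by rw [hcast]; field_simp
  have hn0 : (n : ℝ) ≠ 0 := by linarith
  have hn1 : (n : ℝ) - 1 ≠ 0 := by linarith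
  have hA : (1 : ℝ) + 1 / u = (n : ℝ) / ((n : ℝ) - 1) := by
    rw [hu, eq_div_iff hn1, add_mul, one_mul, one_div, inv_mul_cancel₀ hn1]
    ring
  have hinv : 1 - (n : ℝ)⁻¹ = ((1 : ℝ) + 1 / u)⁻¹ := by
    rw [hA, inv_div, eq_div_iff hn0, sub_mul, one_mul, inv_mul_cancel₀ hn0]
  rw [hinv, inv_pow]
  have he : Real.exp 1 < 25 / 9 := lt_trans Real.exp_one_lt_d9 (by norm_num)
  have hpos : 0 < ((1 : ℝ) + 1 / u) ^ (n - 1) := by positivity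
  calc (9 / 25 : ℝ) = (25 / 9 : ℝ)⁻¹ := by norm_num
    _ ≤ (Real.exp 1)⁻¹ := by
        rw [inv_le_inv₀ (by norm_num) (Real.exp_pos 1)]
        exact he.le
    _ ≤ (((1 : ℝ) + 1 / u) ^ (n - 1))⁻¹ := by
        rw [inv_le_inv₀ (Real.exp_pos 1) hpos]
        exact h2

/-- **Isoperimetric distance of the star parity from monotone functions.** For `n ≥ 8`, every monotone Boolean `F` on the
edges of `K_n` satisfies `‖𝟙[F] − 𝟙[parity of deg(v)]‖_{L¹(G(n,1/n))} ≥ 1/8`: with `L₁`/`L₂` the vectors of star-degree `1`/`2`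
(parity `1`/`0`), `F = 1` at `y ∈ L₁` forces `F = 1` at the `n - 2` vectors `y + e'` (`e'` a further star edge), each of
weight `w(y)·p/(1-p)` and each hit at most twice, so the error is `≥ min(1, (n-2)p/(2(1-p)))·Pr[L₁] = (n-2)/(2n)·(1-1/n)^{n-2} ≥ 1/8`. [folklore] -/
theorem l1_monotone_parity_ge (hn : 8 ≤ n) (v : Fin n) (F : (Edge n → Bool) → Bool) (hF : Monotone F) :
    (1 / 8 : ℝ) ≤ l1 n ((n : ℝ)⁻¹) (ind F) (ind (parityOn (star v))) := by
  set T := star v with hT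
  set p : ℝ := (n : ℝ)⁻¹ with hp
  set w := gnpWeight n p with hw
  have hn0 : (0 : ℝ) < n := by exact_mod_cast (show 0 < n by omega)
  have hn8 : (8 : ℝ) ≤ n := by exact_mod_cast hn
  have hp0 : 0 < p := inv_pos.2 hn0
  have hp1 : p < 1 := inv_lt_one_of_one_lt₀ (by linarith)
  have h1p : 0 < 1 - p := by linarith
  have hTcard : #T = n - 1 := card_star v
  have hw0 : ∀ y, 0 ≤ w y := fun y => gnpWeight_nonneg hp0.le hp1.le y
  -- the ratio `p/(1-p) = 1/(n-1)`
  have hratio : p / (1 - p) = 1 / ((n : ℝ) - 1) := by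
    have hn1 : (n : ℝ) - 1 ≠ 0 := by linarith
    have h1 : 1 - p = ((n : ℝ) - 1) / n := by
      rw [hp, eq_div_iff hn0.ne', sub_mul, one_mul, inv_mul_cancel₀ hn0.ne']
    rw [h1, hp, div_div_eq_mul_div, inv_mul_cancel₀ hn0.ne']
  -- levels
  set L1 := (univ : Finset (Edge n → Bool)).filter fun y => #(T ∩ supp y) = 1 with hL1
  set L2 := (univ : Finset (Edge n → Bool)).filter fun y => #(T ∩ supp y) = 2 with hL2
  set L1F := L1.filter fun y => F y = true with hL1F
  set L2F := L2.filter fun y => F y = true with hL2F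
  have hdisj : Disjoint L1 L2 := by
    rw [hL1, hL2, disjoint_filter]
    intro y _ h1 h2
    omega
  set Err := l1 n p (ind F) (ind (parityOn T)) with hErr
  set A := ∑ y ∈ L1F, w y with hA
  set M1 := ∑ y ∈ L1, w y with hM1
  set S2 := ∑ y ∈ L2F, w y with hS2
  -- (1) restrict the error to the two levels
  have hErr_ge : M1 - A + S2 ≤ Err := by
    have h1 : ∑ y ∈ L1 ∪ L2, w y * |ind F y - ind (parityOn T) y| ≤ Err :=
      sum_le_sum_of_subset_of_nonneg (subset_univ _) fun y _ _ => mul_nonneg (hw0 y) (abs_nonneg _)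
    rw [sum_union hdisj] at h1
    have hL1sum : ∑ y ∈ L1, w y * |ind F y - ind (parityOn T) y| = M1 - A := by
      have : ∀ y ∈ L1, w y * |ind F y - ind (parityOn T) y| = w y - (if F y = true then w y else 0) := by
        intro y hy
        have hpar : parityOn T y = true := parityOn_of_card_eq_one (mem_filter.1 hy).2
        unfold ind
        rw [hpar]
        cases F y <;> simp
      rw [sum_congr rfl this, sum_sub_distrib, ← sum_filter]
    have hL2sum : ∑ y ∈ L2, w y * |ind F y - ind (parityOn T) y| = S2 := by
      have : ∀ y ∈ L2, w y * |ind F y - ind (parityOn T) y| = (if F y = true then w y else 0) := by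
        intro y hy
        have hpar : parityOn T y = false := parityOn_of_card_eq_two (mem_filter.1 hy).2
        unfold ind
        rw [hpar]
        cases F y <;> simp
      rw [sum_congr rfl this, ← sum_filter]
    linarith [hL1sum, hL2sum, h1]
  -- (2) shifting: `S2 ≥ (n-2)/(2(n-1)) · A`
  have hshift : ((n : ℝ) - 2) / ((n : ℝ) - 1) * A ≤ 2 * S2 := by
    -- the pairs `(y, e)`, `y ∈ L1F`, `e ∈ T` off in `y`, and the map `(y,e) ↦ y + e`
    set P := (L1F ×ˢ T).filter fun q : (Edge n → Bool) × Edge n => q.1 q.2 = false with hP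
    set g : (Edge n → Bool) × Edge n → (Edge n → Bool) := fun q => Function.update q.1 q.2 true with hg
    -- `g` maps `P` into `L2F`
    have hmaps : ∀ q ∈ P, g q ∈ L2F := by
      rintro ⟨y, e⟩ hq
      simp only [hP, mem_filter, mem_product] at hq
      obtain ⟨⟨hy, he⟩, hye⟩ := hq
      obtain ⟨hy1, hFy⟩ := mem_filter.1 hy
      have hcard1 : #(T ∩ supp y) = 1 := (mem_filter.1 hy1).2
      have henot : e ∉ T ∩ supp y := by
        rw [mem_inter, mem_supp, hye]
        simp
      rw [hL2F, mem_filter, hL2, mem_filter]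
      refine ⟨⟨mem_univ _, ?_⟩, ?_⟩
      · show #(T ∩ supp (Function.update y e true)) = 2
        rw [supp_update_true, inter_insert_of_mem he, card_insert_of_notMem henot, hcard1]
      · have := hF (le_update_true y e)
        rw [hFy] at this
        exact top_le_iff.1 this
    -- each `z ∈ L2F` is hit at most twice
    have hfib : ∀ z ∈ L2F, (#(P.filter fun q => g q = z) : ℝ) ≤ 2 := by
      intro z hz
      have hz2 : #(T ∩ supp z) = 2 := (mem_filter.1 (mem_filter.1 hz).1).2
      have hle : #(P.filter fun q => g q = z) ≤ #(T ∩ supp z) := by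
        refine card_le_card_of_injOn (fun q => q.2) ?_ ?_
        · rintro ⟨y, e⟩ hq
          simp only [mem_coe, mem_filter, hP, mem_product] at hq
          obtain ⟨⟨⟨_, he⟩, _⟩, hgz⟩ := hq
          rw [mem_coe, mem_inter, mem_supp]
          refine ⟨he, ?_⟩
          rw [← hgz]
          simp [hg]
        · rintro ⟨y, e⟩ hq ⟨y', e'⟩ hq' (hee : e = e')
          simp only [mem_coe, mem_filter, hP, mem_product] at hq hq'
          obtain ⟨⟨_, hye⟩, hgz⟩ := hq
          obtain ⟨⟨_, hye'⟩, hgz'⟩ := hq'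
          subst hee
          have hy : y = Function.update z e false := by
            rw [← hgz, hg]
            simp only [Function.update_idem]
            rw [← hye, Function.update_eq_self]
          have hy' : y' = Function.update z e false := by
            rw [← hgz', hg]
            simp only [Function.update_idem]
            rw [← hye', Function.update_eq_self]
          rw [hy, hy']
      calc (#(P.filter fun q => g q = z) : ℝ) ≤ #(T ∩ supp z) := by exact_mod_cast hle
        _ = 2 := by rw [hz2]; norm_num
    -- the double count
    have hsum_le : ∑ q ∈ P, w (g q) ≤ 2 * S2 := by
      rw [← sum_fiberwise_of_maps_to' hmaps, hS2, mul_sum]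
      refine sum_le_sum fun z hz => ?_
      rw [sum_const, nsmul_eq_mul]
      exact mul_le_mul_of_nonneg_right (hfib z hz) (hw0 z)
    -- the pair sum, computed from the `L1F` side
    have hsum_eq : ∑ q ∈ P, w (g q) = ((n : ℝ) - 2) * (p / (1 - p)) * A := by
      rw [hP, sum_filter, sum_product, hA, mul_sum]
      refine sum_congr rfl fun y hy => ?_
      have hy1 : #(T ∩ supp y) = 1 := (mem_filter.1 (mem_filter.1 hy).1).2
      have hinner : ∀ e ∈ T, (if y e = false then w (g (y, e)) else 0) = if y e = false then w y * (p / (1 - p)) else 0 := by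
        intro e _
        split_ifs with hye
        · rw [hg]
          show gnpWeight n p (Function.update y e true) = gnpWeight n p y * (p / (1 - p))
          rw [mul_div_assoc', eq_div_iff h1p.ne']
          exact gnpWeight_update_true p hye
        · rfl
      rw [sum_congr rfl hinner, ← sum_filter, sum_const, nsmul_eq_mul]
      have hoff : #(T.filter fun e => y e = false) = n - 2 := by
        have h := Finset.card_filter_add_card_filter_not (s := T) (fun e => y e = true)
        have hon : T.filter (fun e => y e = true) = T ∩ supp y := by
          ext e; simp [mem_supp]
        have hoff' : T.filter (fun e => ¬ y e = true) = T.filter (fun e => y e = false) := by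
          ext e; simp
        rw [hon, hoff', hy1, hTcard] at h
        omega
      rw [hoff, Nat.cast_sub (by omega)]
      push_cast
      ring
    rw [hratio] at hsum_eq
    have : ((n : ℝ) - 2) / ((n : ℝ) - 1) * A = ((n : ℝ) - 2) * (1 / ((n : ℝ) - 1)) * A := by ring
    rw [this, ← hsum_eq]
    exact hsum_le
  -- (3) the mass of level one: `M1 ≥ (n-1) p (1-p)^{n-2}`
  have hM1 : ((n : ℝ) - 1) * p * (1 - p) ^ (n - 2) ≤ M1 := by
    -- the disjoint patterns `y ∩ T = {e}`
    set Ae : Edge n → Finset (Edge n → Bool) := fun e =>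
      univ.filter fun y => y e = true ∧ ∀ e' ∈ T.erase e, y e' = false with hAe
    have hAsub : ∀ e ∈ T, Ae e ⊆ L1 := by
      intro e he y hy
      rw [hAe, mem_filter] at hy
      obtain ⟨-, hye, hoff⟩ := hy
      rw [hL1, mem_filter]
      refine ⟨mem_univ _, ?_⟩
      have : T ∩ supp y = {e} := by
        ext a
        rw [mem_inter, mem_supp, mem_singleton]
        constructor
        · rintro ⟨haT, hya⟩
          by_contra hne
          have := hoff a (mem_erase.2 ⟨hne, haT⟩)
          rw [hya] at this
          exact Bool.noConfusion this
        · rintro rfl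
          exact ⟨he, hye⟩
      rw [this, card_singleton]
    have hAdisj : (T : Set (Edge n)).PairwiseDisjoint Ae := by
      intro e he e' he' hne
      rw [Function.onFun, disjoint_left]
      intro y hy hy'
      rw [hAe, mem_filter] at hy hy'
      have h1 := hy'.2.2 e (mem_erase.2 ⟨hne, he⟩)
      rw [hy.2.1] at h1
      exact Bool.noConfusion h1
    have hAprob : ∀ e ∈ T, ∑ y ∈ Ae e, w y = p * (1 - p) ^ (n - 2) := by
      intro e he
      have hind := gnpProb_and_eq_mul ({e} : Finset (Edge n))
        (fun y : Edge n → Bool => y e = true) (fun y => ∀ e' ∈ T.erase e, y e' = false)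
        (fun x y hxy => by rw [hxy e (mem_singleton_self e)])
        (fun x y hxy => by
          refine forall₂_congr fun e' he' => ?_
          rw [hxy e' (by rw [mem_singleton]; exact (mem_erase.1 he').1)])
        p
      have hPe : gnpProb n p (univ.filter fun y : Edge n → Bool => y e = true) = p := by
        have := sum_gnpWeight_filter_forall (n := n) p ({e} : Finset (Edge n))
        simp only [mem_singleton, forall_eq, card_singleton, pow_one] at this
        rw [gnpProb]
        exact this
      have hQe : gnpProb n p (univ.filter fun y : Edge n → Bool => ∀ e' ∈ T.erase e, y e' = false) = (1 - p) ^ (n - 2) := by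
        rw [gnpProb_forall_off, card_erase_of_mem he, hTcard,
          Nat.sub_sub]
      rw [hPe, hQe] at hind
      rw [← hind, gnpProb]
    calc ((n : ℝ) - 1) * p * (1 - p) ^ (n - 2) = ∑ e ∈ T, p * (1 - p) ^ (n - 2) := by
          rw [sum_const, nsmul_eq_mul, hTcard, Nat.cast_sub (by omega), Nat.cast_one]; ring
      _ = ∑ e ∈ T, ∑ y ∈ Ae e, w y := sum_congr rfl fun e he => (hAprob e he).symm
      _ = ∑ y ∈ T.biUnion Ae, w y := (sum_biUnion hAdisj).symm
      _ ≤ M1 := sum_le_sum_of_subset_of_nonneg (biUnion_subset.2 hAsub) fun y _ _ => hw0 y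
  -- (4) combine
  have hAM : A ≤ M1 := sum_le_sum_of_subset_of_nonneg (filter_subset _ _) fun y _ _ => hw0 y
  have hA0 : 0 ≤ A := sum_nonneg fun y _ => hw0 y
  set κ : ℝ := ((n : ℝ) - 2) / (2 * ((n : ℝ) - 1)) with hκ
  have hκ1 : κ ≤ 1 := by
    rw [hκ, div_le_one (by linarith)]; linarith
  have hκ0 : 0 ≤ κ := by rw [hκ]; exact div_nonneg (by linarith) (by linarith)
  have hS2κ : κ * A ≤ S2 := by
    have : κ * A = (((n : ℝ) - 2) / ((n : ℝ) - 1) * A) / 2 := by rw [hκ]; field_simp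
    rw [this]
    linarith [hshift]
  have hmain : κ * M1 ≤ Err := by
    have : κ * M1 ≤ M1 - A + κ * A := by nlinarith
    linarith [hErr_ge]
  -- numerics: `κ M1 ≥ (n-2)/(2n) (1-1/n)^{n-2} ≥ (3/8)(9/25) ≥ 1/8`
  have hpow : (9 / 25 : ℝ) ≤ (1 - p) ^ (n - 2) := by
    calc (9 / 25 : ℝ) ≤ (1 - p) ^ (n - 1) := pow_one_sub_inv_ge (by omega)
      _ ≤ (1 - p) ^ (n - 2) := pow_le_pow_of_le_one h1p.le (by linarith) (by omega)
  have hκM : (3 / 8 : ℝ) * (9 / 25) ≤ κ * M1 := by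
    have h1 : κ * (((n : ℝ) - 1) * p * (1 - p) ^ (n - 2)) ≤ κ * M1 := mul_le_mul_of_nonneg_left hM1 hκ0
    have h2 : κ * (((n : ℝ) - 1) * p) = ((n : ℝ) - 2) / (2 * n) := by
      rw [hκ, hp]
      have hn1 : (n : ℝ) - 1 ≠ 0 := by linarith
      field_simp
    have h3 : (3 / 8 : ℝ) ≤ ((n : ℝ) - 2) / (2 * n) := by
      rw [le_div_iff₀ (by linarith)]; linarith
    calc (3 / 8 : ℝ) * (9 / 25) ≤ ((n : ℝ) - 2) / (2 * n) * (1 - p) ^ (n - 2) :=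
          mul_le_mul h3 hpow (by norm_num) (div_nonneg (by linarith) (by linarith))
      _ = κ * (((n : ℝ) - 1) * p * (1 - p) ^ (n - 2)) := by rw [← h2]; ring
      _ ≤ κ * M1 := h1
  linarith [hκM, hmain]

/-! ### Numerics shared by the assembly files -/

/-- Pure-real bookkeeping: `(A⁴ + 1)·A ≤ 2A⁶` for `A ≥ 1`. [folklore] -/
theorem numerics_aux {A : ℝ} (hA1 : 1 ≤ A) : (A ^ 4 + 1) * A ≤ 8 * (A ^ 3 / 2) ^ 2 := by
  have hA0 : 0 < A := by linarith
  have h5 : A ^ 5 ≤ A ^ 6 := pow_le_pow_right₀ hA1 (by norm_num)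
  have h1 : A ≤ A ^ 6 := le_self_pow₀ hA1 (by norm_num)
  nlinarith [h5, h1]

end

end Summit.PneNP.PneNP.Theorems.MonotoneContinuation.Negative
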